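import Literature.NumberTheory.NumberFields.StickelbergerGaussSum
import Literature.NumberTheory.NumberFields.StickelbergerIdeal
import HarnessLib

/-!
# Stickelberger's theorem via Jacobi sums, II: [Schoof2009, Theorem 9.5]

**Stickelberger's theorem for primes of degree one** (E. E. Kummer 1847 for `ℚ(ζ_p)`,
L. Stickelberger 1890; [Schoof2009, Theorem 9.5]): *let `p` be an odd prime, `K = ℚ(ζ_p)`,
`G = {σ_c}` its Galois group, and `𝔩` a prime of `𝓞 K` of degree one, i.e. lying over a prime
`l ≡ 1 (mod p)`. Then `𝔩^θ` is principal for every element `θ` of the Stickelberger ideal.* We prove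
it for the generators `θ_b = ∑_c ⌊bc/p⌋ σ_c⁻¹` (`Stickelberger.theta`, file `StickelbergerIdeal`)
and for `f_b = θ_{b+1} - θ_b`, in the concrete form needed later:

* `Stickelberger.isPrincipal_idealPow_quot` — `𝔩^{θ_b} = ∏_c (σ_c⁻¹ 𝔩)^{⌊bc/p⌋}` is principal;
* `Stickelberger.isPrincipal_idealPow_quot_sub` — `𝔩^{f_b}` is principal;
* `Stickelberger.isPrincipal_idealPow_quot_of_factors`, `…_quot_sub_of_factors` — the same for
  every non-zero ideal all of whose prime factors lie over primes `l ≡ 1 (mod p)` (which is the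
  case for the ideals met in the proof of Catalan's conjecture, so that the generation statement
  [Schoof2009, Theorem 9.6] is not needed there);

with the explicit generators of [Schoof2009, proof of Theorem 9.5]:
`Stickelberger.prod_Pc_pow_val_eq_span` — `𝔩^{θ_p} = (σ_a g(χ))`, `g(χ) = τ(χ)^p` — and
`Stickelberger.prod_Pc_pow_quot_eq_span` — `𝔩^{θ_b} = (σ_a D_b(χ))`, `D_b(χ) = ∏_{j<b} J(χ, χ^j)`.

The proof follows [Schoof2009, pp. 63–64] with the two inputs of `StickelbergerGaussSum` in place
of Kummer theory and ramification: writing `x(Q) = ord_Q (g(χ))` for primes `Q` of `𝓞 K`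
(`Stickelberger.ord`, exponents in the prime factorisation), one has
`b · x(Q) ≡ x(σ_b⁻¹ Q) (mod p)` (`val_mul_ord`, from `g^b = g(χ^b) D_b^p` and `g(χ^b) = σ_b g`),
`1 ≤ x(Q) ≤ p - 1` for `Q ∣ l` (`one_le_ord`, `ord_add_ord_neg`, from `g ∈ Q` and `g ḡ = l^p`),
the primes over `l` are the `p - 1` distinct conjugates `P_c = σ_c⁻¹ 𝔩` (`Pc_injective`: the
decomposition group is trivial as `l ≡ 1 (mod p)`, Mathlib's
`mem_zpowers_galEquivZMod_of_mem_stabilizer`; `exists_Pc_eq`: transitivity), hence for a suitable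
`a` one has `x(P_{ab}) = b` for all `b` (`exists_good`: "the set `{x_a}` is `{1, …, p-1}`"), and
comparing exponents prime by prime gives the two displayed ideal identities.

Everything is proved; the definitions are `ord`, the conjugates `Pc` and the operation
`idealPow n 𝔞 = ∏_c (σ_c⁻¹ 𝔞)^{n c}` (`𝔞^θ` for `θ = ∑ n_c σ_c⁻¹` with `n ≥ 0`).
-/

open NumberField IsCyclotomicExtension Finset UniqueFactorizationMonoid
open scoped Pointwise

namespace Literature.NumberTheory.NumberFields.Stickelberger

section Ord

/-! ### Exponents in prime factorisations of ideals -/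

variable {R : Type*} [CommRing R] [IsDedekindDomain R]

/-- `ord P I`, the exponent of the prime ideal `P` in the factorisation of the ideal `I` of a Dedekind
domain (the multiplicity of `P` in `normalizedFactors I`). [folklore] -/
noncomputable def ord (P I : Ideal R) : ℕ := (normalizedFactors I).count P

/-- `ord_P (I J) = ord_P I + ord_P J` for non-zero ideals. [folklore] -/
theorem ord_mul (P : Ideal R) {I J : Ideal R} (hI : I ≠ ⊥) (hJ : J ≠ ⊥) :
    ord P (I * J) = ord P I + ord P J := by
  classical
  rw [ord, normalizedFactors_mul hI hJ, Multiset.count_add, ord, ord]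

/-- `ord_P (I^n) = n · ord_P I`. [folklore] -/
theorem ord_pow (P I : Ideal R) (n : ℕ) : ord P (I ^ n) = n * ord P I := by
  classical
  rw [ord, normalizedFactors_pow, Multiset.count_nsmul, ord]

/-- `ord_P (∏ I_i) = ∑ ord_P I_i` for non-zero ideals. [folklore] -/
theorem ord_prod (P : Ideal R) {ι : Type*} (s : Finset ι) (I : ι → Ideal R)
    (hI : ∀ i ∈ s, I i ≠ ⊥) : ord P (∏ i ∈ s, I i) = ∑ i ∈ s, ord P (I i) := by
  classical
  induction s using Finset.induction_on with
  | empty =>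
    simp only [Finset.prod_empty, Finset.sum_empty, ord]
    rw [normalizedFactors_one, Multiset.count_zero]
  | insert j s hj ih =>
    rw [Finset.prod_insert hj, Finset.sum_insert hj, ord_mul _ (hI j (Finset.mem_insert_self j s))
      (Finset.prod_ne_zero_iff.mpr fun i hi => hI i (Finset.mem_insert_of_mem hi)),
      ih fun i hi => hI i (Finset.mem_insert_of_mem hi)]

/-- `ord_P P = 1` for a non-zero prime `P`. [folklore] -/
theorem ord_self {P : Ideal R} [hP : P.IsPrime] (hP0 : P ≠ ⊥) : ord P P = 1 := by
  classical
  rw [ord, normalizedFactors_irreducible (Ideal.prime_of_isPrime hP0 hP).irreducible,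
    normalize_eq, Multiset.count_singleton_self]

/-- `ord_P Q = 0` for distinct non-zero primes. [folklore] -/
theorem ord_eq_zero_of_ne {P Q : Ideal R} [hQ : Q.IsPrime] (hQ0 : Q ≠ ⊥) (h : P ≠ Q) :
    ord P Q = 0 := by
  classical
  rw [ord, normalizedFactors_irreducible (Ideal.prime_of_isPrime hQ0 hQ).irreducible,
    normalize_eq, Multiset.count_singleton, if_neg h]

/-- `n ≤ ord_P I ↔ I ≤ P^n` (i.e. `P^n ∣ I`). [folklore] -/
theorem le_ord_iff {P I : Ideal R} [hP : P.IsPrime] (hP0 : P ≠ ⊥) (hI : I ≠ ⊥) (n : ℕ) :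
    n ≤ ord P I ↔ I ≤ P ^ n := by
  classical
  rw [← Ideal.dvd_iff_le, dvd_iff_normalizedFactors_le_normalizedFactors (pow_ne_zero _ hP0) hI,
    normalizedFactors_pow, normalizedFactors_irreducible (Ideal.prime_of_isPrime hP0 hP).irreducible,
    normalize_eq, Multiset.le_iff_count, ord]
  constructor
  · intro h Q
    rw [Multiset.count_nsmul, Multiset.count_singleton]
    split_ifs with hQ
    · subst hQ; simpa using h
    · simp
  · intro h
    have := h P
    rwa [Multiset.count_nsmul, Multiset.count_singleton_self, mul_one] at this

/-- `ord_P I ≠ 0 ↔ I ≤ P`. [folklore] -/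
theorem ord_ne_zero_iff {P I : Ideal R} [hP : P.IsPrime] (hP0 : P ≠ ⊥) (hI : I ≠ ⊥) :
    ord P I ≠ 0 ↔ I ≤ P := by
  rw [← Nat.one_le_iff_ne_zero, le_ord_iff hP0 hI, pow_one]

/-- Two non-zero ideals with the same exponent at every non-zero prime are equal (unique
factorisation). [folklore] -/
theorem eq_of_ord_eq {I J : Ideal R} (hI : I ≠ ⊥) (hJ : J ≠ ⊥)
    (h : ∀ P : Ideal R, P.IsPrime → P ≠ ⊥ → ord P I = ord P J) : I = J := by
  classical
  rw [← Ideal.prod_normalizedFactors_eq_self hI, ← Ideal.prod_normalizedFactors_eq_self hJ]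
  congr 1
  ext P
  by_cases hP : P.IsPrime ∧ P ≠ ⊥
  · haveI := hP.1
    exact h P hP.1 hP.2
  · have h1 : ∀ L : Ideal R, L ≠ ⊥ → Multiset.count P (normalizedFactors L) = 0 := by
      intro L hL
      rw [Multiset.count_eq_zero]
      intro hmem
      apply hP
      exact ⟨Ideal.isPrime_of_prime (prime_of_normalized_factor P hmem),
        (prime_of_normalized_factor P hmem).ne_zero⟩
    rw [h1 I hI, h1 J hJ]

/-- `ord` is invariant under a ring automorphism applied to both arguments. [folklore] -/
theorem ord_smul {G : Type*} [Group G] [MulSemiringAction G R] (σ : G) {P I : Ideal R}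
    [hP : P.IsPrime] (hP0 : P ≠ ⊥) (hI : I ≠ ⊥) : ord (σ • P) (σ • I) = ord P I := by
  have hP0' : σ • P ≠ ⊥ := by
    intro h
    apply hP0
    have := congrArg (fun J : Ideal R => σ⁻¹ • J) h
    simpa only [inv_smul_smul, Ideal.smul_bot] using this
  have hI' : σ • I ≠ ⊥ := by
    intro h
    apply hI
    have := congrArg (fun J : Ideal R => σ⁻¹ • J) h
    simpa only [inv_smul_smul, Ideal.smul_bot] using this
  have hpow : ∀ n : ℕ, (σ • P) ^ n = σ • P ^ n := by
    intro n
    rw [Ideal.pointwise_smul_def, Ideal.pointwise_smul_def, Ideal.map_pow]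
  apply le_antisymm
  · rw [le_ord_iff hP0 hI, ← Ideal.pointwise_smul_le_pointwise_smul_iff (a := σ), ← hpow,
      ← le_ord_iff hP0' hI']
  · rw [le_ord_iff hP0' hI', hpow, Ideal.pointwise_smul_le_pointwise_smul_iff, ← le_ord_iff hP0 hI]

end Ord

section DegreeOne

/-! ### The exponents `x(Q) = ord_Q(g(χ))` [Schoof2009, proof of Theorem 9.5] -/

variable {p : ℕ} [hp : Fact p.Prime] {K : Type*} [Field K] [NumberField K]
  [hK : IsCyclotomicExtension {p} ℚ K]
variable {l : ℕ} [hl : Fact l.Prime]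

/-- `l ≠ 0` in `𝓞 K`. [folklore] -/
theorem natCast_l_ne_zero : (l : 𝓞 K) ≠ 0 := by
  exact_mod_cast hl.out.ne_zero

omit hK in
/-- `g(χ) ≠ 0` (as `g(χ) g(χ⁻¹) = l^p`). [folklore] -/
theorem gElt_ne_zero {χ : MulChar (ZMod l) (𝓞 K)} (hχ : orderOf χ = p) (hp2 : p ≠ 2) :
    gElt χ ≠ 0 := by
  intro h
  have := gElt_mul_gElt_inv hχ hp2
  rw [h, zero_mul] at this
  exact pow_ne_zero p natCast_l_ne_zero this.symm

omit hK in
/-- `D_b(χ) ≠ 0` for `0 < b < p`. [folklore] -/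
theorem jacProd_ne_zero {χ : MulChar (ZMod l) (𝓞 K)} (hχ : orderOf χ = p) (hp2 : p ≠ 2) {b : ℕ}
    (hb0 : 0 < b) (hb : b < p) : jacProd χ b ≠ 0 := by
  intro h
  have := gElt_pow hχ hb0 hb
  rw [h, zero_pow hp.out.ne_zero, mul_zero] at this
  exact pow_ne_zero b (gElt_ne_zero hχ hp2) this

omit [NumberField K] in
/-- A prime of `𝓞 K` containing the rational prime `l` lies over `(l)`. [folklore] -/
theorem liesOver_of_mem {Q : Ideal (𝓞 K)} [hQ : Q.IsPrime] (hlQ : (l : 𝓞 K) ∈ Q) :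
    Q.LiesOver (Ideal.span {(l : ℤ)}) := by
  have hmax : (Ideal.span {(l : ℤ)}).IsMaximal :=
    ((Ideal.span_singleton_prime (by exact_mod_cast hl.out.ne_zero)).mpr
      (Nat.prime_iff_prime_int.mp hl.out)).isMaximal (by simpa using hl.out.ne_zero)
  refine ⟨hmax.eq_of_le (Ideal.IsPrime.ne_top inferInstance) ?_⟩
  rw [Ideal.span_singleton_le_iff_mem, Ideal.under_def, Ideal.mem_comap, map_natCast]
  exact hlQ

/-- A prime containing `l` is non-zero. [folklore] -/
theorem ne_bot_of_mem {Q : Ideal (𝓞 K)} (hlQ : (l : 𝓞 K) ∈ Q) : Q ≠ ⊥ := by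
  intro h
  rw [h, Ideal.mem_bot] at hlQ
  exact natCast_l_ne_zero hlQ

/-- `ord_Q (l) = 1` for every prime `Q` over `l ≠ p`: `l` is unramified in `ℚ(ζ_p)` (Mathlib's
`IsCyclotomicExtension.Rat.ramificationIdx_eq_of_not_dvd`). [folklore] -/
theorem ord_span_l {Q : Ideal (𝓞 K)} [hQ : Q.IsPrime] (hlQ : (l : 𝓞 K) ∈ Q) (hlp : l ≠ p) :
    ord Q (Ideal.span {(l : 𝓞 K)}) = 1 := by
  classical
  haveI := liesOver_of_mem hlQ
  have hmap : Ideal.map (algebraMap ℤ (𝓞 K)) (Ideal.span {(l : ℤ)}) = Ideal.span {(l : 𝓞 K)} := by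
    rw [Ideal.map_span, Set.image_singleton, map_natCast]
  have h1 := Ideal.IsDedekindDomain.ramificationIdx_eq_normalizedFactors_count (Ideal.span {(l : ℤ)}) Q
    (by rw [hmap]; exact (Ideal.span_singleton_eq_bot.not).mpr natCast_l_ne_zero)
  rw [hmap] at h1
  rw [ord, ← h1]
  exact IsCyclotomicExtension.Rat.ramificationIdx_eq_of_not_dvd l K Q
    (fun h => hlp ((Nat.prime_dvd_prime_iff_eq hl.out hp.out).mp h))

/-- `σ (x) = (σ x)` for principal ideals. [folklore] -/
theorem span_smul_singleton (σ : Gal(K/ℚ)) (x : 𝓞 K) :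
    σ • Ideal.span {x} = Ideal.span {σ • x} := by
  rw [Ideal.smul_closure, Set.smul_set_singleton]

/-- `ord_Q (σ I) = ord_{σ⁻¹ Q} I`. [folklore] -/
theorem ord_smul' (σ : Gal(K/ℚ)) {Q I : Ideal (𝓞 K)} [Q.IsPrime] (hQ0 : Q ≠ ⊥) (hI : I ≠ ⊥) :
    ord Q (σ • I) = ord (σ⁻¹ • Q) I := by
  have h := ord_smul σ⁻¹ (P := Q) (I := σ • I) hQ0 ?_
  · rw [inv_smul_smul] at h
    exact h.symm
  · intro h0
    apply hI
    have := congrArg (fun J : Ideal (𝓞 K) => σ⁻¹ • J) h0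
    simpa only [inv_smul_smul, Ideal.smul_bot] using this

/-- **The congruence `x_{cb} ≡ b x_c (mod p)`** of [Schoof2009, p. 64], in the form
`b · ord_Q(g) = ord_{σ_b⁻¹ Q}(g) + p · ord_Q(D_b)` for every prime `Q` (from `(g)^b = σ_b(g) · (D_b)^p`).
[cite: Schoof2009, Theorem 9.5 (proof, p. 64)] -/
theorem val_mul_ord {χ : MulChar (ZMod l) (𝓞 K)} (hχ : orderOf χ = p) (hp2 : p ≠ 2)
    (Q : Ideal (𝓞 K)) [Q.IsPrime] (hQ0 : Q ≠ ⊥) (b : (ZMod p)ˣ) :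
    (b : ZMod p).val * ord Q (Ideal.span {gElt χ}) =
      ord ((gal p K b)⁻¹ • Q) (Ideal.span {gElt χ}) +
        p * ord Q (Ideal.span {jacProd χ (b : ZMod p).val}) := by
  have hb0 := val_pos b
  have hb := ZMod.val_lt (b : ZMod p)
  have e := gElt_pow hχ hb0 hb
  rw [← gal_smul_gElt hχ b] at e
  have hg := gElt_ne_zero hχ hp2
  have hD := jacProd_ne_zero hχ hp2 hb0 hb
  have e' : Ideal.span {gElt χ} ^ (b : ZMod p).val =
      (gal p K b • Ideal.span {gElt χ}) * Ideal.span {jacProd χ (b : ZMod p).val} ^ p := by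
    rw [span_smul_singleton, Ideal.span_singleton_pow, Ideal.span_singleton_pow,
      Ideal.span_singleton_mul_span_singleton, e]
  have h1 : gal p K b • Ideal.span {gElt χ} ≠ ⊥ := by
    rw [span_smul_singleton, Ne, Ideal.span_singleton_eq_bot]
    intro h0
    apply hg
    have := congrArg (fun y => (gal p K b)⁻¹ • y) h0
    simpa using this
  have h2 : Ideal.span {jacProd χ (b : ZMod p).val} ^ p ≠ ⊥ :=
    pow_ne_zero _ ((Ideal.span_singleton_eq_bot.not).mpr hD)
  have := congrArg (ord Q) e'
  rw [ord_pow, ord_mul _ h1 h2, ord_pow, ord_smul' _ hQ0 ((Ideal.span_singleton_eq_bot.not).mpr hg)]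
    at this
  exact this

omit hK in
/-- `ord_Q(g) ≥ 1` for every prime `Q` over `l` (every `x_a ≥ 1`; from `gElt_mem`).
[cite: Schoof2009, Theorem 9.5 (proof, p. 64)] -/
theorem one_le_ord {χ : MulChar (ZMod l) (𝓞 K)} (hχ : orderOf χ = p) (hp2 : p ≠ 2)
    {Q : Ideal (𝓞 K)} [Q.IsPrime] (hlQ : (l : 𝓞 K) ∈ Q) : 1 ≤ ord Q (Ideal.span {gElt χ}) := by
  rw [Nat.one_le_iff_ne_zero, ord_ne_zero_iff (ne_bot_of_mem hlQ)
    ((Ideal.span_singleton_eq_bot.not).mpr (gElt_ne_zero hχ hp2)), Ideal.span_singleton_le_iff_mem]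
  exact gElt_mem hχ Q hlQ

omit [NumberField K] hK hl in
/-- `χ^(p-1) = χ⁻¹` for `χ` of order `p`. [folklore] -/
theorem pow_orderOf_sub_one {χ : MulChar (ZMod l) (𝓞 K)} (hχ : orderOf χ = p) :
    χ ^ (p - 1) = χ⁻¹ := by
  apply eq_inv_of_mul_eq_one_left
  rw [← pow_succ, Nat.sub_add_cancel hp.out.one_lt.le, ← hχ, pow_orderOf_eq_one]

/-- `ord_Q(g) + ord_{σ_{-1}⁻¹ Q}(g) = p` for every prime `Q` over `l` (from `g · σ_{-1}(g) = l^p` and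
`ord_Q(l) = 1`): the exponents satisfy `x_a + x_{-a} = p`, so `1 ≤ x_a ≤ p - 1`.
[cite: Schoof2009, Theorem 9.5 (proof, p. 63–64)] -/
theorem ord_add_ord_neg {χ : MulChar (ZMod l) (𝓞 K)} (hχ : orderOf χ = p) (hp2 : p ≠ 2)
    (hlp : l ≠ p) {Q : Ideal (𝓞 K)} [Q.IsPrime] (hlQ : (l : 𝓞 K) ∈ Q) :
    ord Q (Ideal.span {gElt χ}) + ord ((gal p K (-1))⁻¹ • Q) (Ideal.span {gElt χ}) = p := by
  have hg := gElt_ne_zero hχ hp2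
  have e := gElt_mul_gElt_inv hχ hp2
  have hneg : gal p K (-1) • gElt χ = gElt χ⁻¹ := by
    rw [gal_smul_gElt hχ, Units.val_neg, Units.val_one, ZMod.neg_val, if_neg one_ne_zero, ZMod.val_one,
      pow_orderOf_sub_one hχ]
  rw [← hneg] at e
  have e' : Ideal.span {gElt χ} * (gal p K (-1) • Ideal.span {gElt χ}) =
      Ideal.span {(l : 𝓞 K)} ^ p := by
    rw [span_smul_singleton, Ideal.span_singleton_mul_span_singleton, e, Ideal.span_singleton_pow]
  have h1 : gal p K (-1) • Ideal.span {gElt χ} ≠ ⊥ := by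
    rw [span_smul_singleton, Ne, Ideal.span_singleton_eq_bot]
    intro h0
    apply hg
    have := congrArg (fun y => (gal p K (-1))⁻¹ • y) h0
    simpa using this
  have := congrArg (ord Q) e'
  rw [ord_mul _ ((Ideal.span_singleton_eq_bot.not).mpr hg) h1, ord_pow, ord_span_l hlQ hlp, mul_one,
    ord_smul' _ (ne_bot_of_mem hlQ) ((Ideal.span_singleton_eq_bot.not).mpr hg)] at this
  exact this

/-! ### The conjugates `P_c = σ_c⁻¹ 𝔩` of a prime `𝔩` of degree one -/

variable (𝔩 : Ideal (𝓞 K)) [h𝔩 : 𝔩.IsPrime]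

/-- The conjugates `P_c = σ_c⁻¹ 𝔩` of the prime `𝔩`. [cite: Schoof2009, Theorem 9.5 (proof, p. 63)] -/
noncomputable def Pc (c : (ZMod p)ˣ) : Ideal (𝓞 K) := (gal p K c)⁻¹ • 𝔩

/-- `P_c` is prime. [folklore] -/
instance Pc.isPrime (c : (ZMod p)ˣ) : (Pc 𝔩 c).IsPrime := by
  unfold Pc; infer_instance

omit h𝔩 in
/-- `P_{cd} = σ_d⁻¹ P_c`. [folklore] -/
theorem Pc_mul (c d : (ZMod p)ˣ) : Pc 𝔩 (c * d) = (gal p K d)⁻¹ • Pc 𝔩 c := by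
  rw [Pc, Pc, gal_mul, mul_inv_rev, mul_smul]

omit hl h𝔩 in
/-- `l ∈ P_c`. [folklore] -/
theorem mem_Pc {c : (ZMod p)ˣ} (hl𝔩 : (l : 𝓞 K) ∈ 𝔩) : (l : 𝓞 K) ∈ Pc 𝔩 c := by
  have := Ideal.smul_mem_pointwise_smul (gal p K c)⁻¹ (l : 𝓞 K) 𝔩 hl𝔩
  rwa [gal_smul_natCast] at this

/-- `a ↦ σ_a` is injective. [folklore] -/
theorem gal_injective : Function.Injective (gal p K) :=
  (Rat.galEquivZMod p K).symm.injective

/-- **The primes over `l ≡ 1 (mod p)` have trivial decomposition group**: if `σ 𝔩 = 𝔩` then `σ = 1`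
(the decomposition group maps to `⟨[l]⟩ = 1` in `(ℤ/pℤ)ˣ`, Mathlib's
`IsCyclotomicExtension.Rat.mem_zpowers_galEquivZMod_of_mem_stabilizer`). This is where "`𝔩` has
degree one" enters. [cite: Schoof2009, Theorem 9.5 (proof, p. 63: "`𝔩` of degree `1`, `l ≡ 1 (mod p)`")] -/
theorem eq_one_of_smul_eq (hpl : p ∣ l - 1) (hl𝔩 : (l : 𝓞 K) ∈ 𝔩) {σ : Gal(K/ℚ)} (hσ : σ • 𝔩 = 𝔩) :
    σ = 1 := by
  haveI := liesOver_of_mem hl𝔩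
  haveI : 𝔩.IsMaximal := Ideal.IsPrime.isMaximal h𝔩 (ne_bot_of_mem hl𝔩)
  have hlp : l ≠ p := by
    rintro rfl
    have h2 := hl.out.two_le
    have := Nat.le_of_dvd (by omega) hpl
    omega
  have hn : l.Coprime p := (Nat.coprime_primes hl.out hp.out).mpr hlp
  have h := IsCyclotomicExtension.Rat.mem_zpowers_galEquivZMod_of_mem_stabilizer p K l 𝔩 hn
    (MulAction.mem_stabilizer_iff.mpr hσ)
  have hu : ZMod.unitOfCoprime l hn = 1 := by
    ext
    rw [ZMod.coe_unitOfCoprime, Units.val_one]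
    have : (l : ZMod p) = ((1 : ℕ) : ZMod p) := by
      rw [ZMod.natCast_eq_natCast_iff']
      have h2 := hl.out.two_le
      have : l % p = 1 % p := by
        obtain ⟨k, hk⟩ := hpl
        have : l = p * k + 1 := by omega
        rw [this, Nat.mul_add_mod]
      exact this
    rwa [Nat.cast_one] at this
  rw [hu, Subgroup.zpowers_one_eq_bot, Subgroup.mem_bot] at h
  exact (MulEquiv.map_eq_one_iff _).mp h

/-- The conjugates `P_c = σ_c⁻¹ 𝔩`, `c ∈ (ℤ/pℤ)ˣ`, are pairwise distinct. [cite: Schoof2009, Theorem 9.5 (proof)] -/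
theorem Pc_injective (hpl : p ∣ l - 1) (hl𝔩 : (l : 𝓞 K) ∈ 𝔩) :
    Function.Injective (Pc (p := p) 𝔩) := by
  intro c d h
  simp only [Pc] at h
  have h2 : (gal p K d * (gal p K c)⁻¹) • 𝔩 = 𝔩 := by
    rw [mul_smul, h, smul_inv_smul]
  have h3 := eq_one_of_smul_eq 𝔩 hpl hl𝔩 h2
  rw [← gal_inv (p := p) (K := K), ← gal_mul (p := p) (K := K), ← gal_one (p := p) (K := K)] at h3
  have h4 := gal_injective h3
  have : d = c := by
    have := congrArg (· * c) h4
    simpa using this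
  exact this.symm

/-- Every prime of `𝓞 K` over `l` is one of the `P_c` (the Galois group acts transitively on the primes
over `l`, Mathlib's `Ideal.exists_smul_eq_of_isGaloisGroup`). [folklore] -/
theorem exists_Pc_eq (hl𝔩 : (l : 𝓞 K) ∈ 𝔩) {Q : Ideal (𝓞 K)} [Q.IsPrime] (hlQ : (l : 𝓞 K) ∈ Q) :
    ∃ c : (ZMod p)ˣ, Pc 𝔩 c = Q := by
  haveI := liesOver_of_mem hl𝔩
  haveI := liesOver_of_mem hlQ
  haveI : IsGalois ℚ K := IsCyclotomicExtension.isGalois {p} ℚ K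
  obtain ⟨σ, hσ⟩ := Ideal.exists_smul_eq_of_isGaloisGroup (Ideal.span {(l : ℤ)}) 𝔩 Q Gal(K/ℚ)
  refine ⟨(Rat.galEquivZMod p K σ)⁻¹, ?_⟩
  rw [Pc, gal_inv (p := p) (K := K), inv_inv, gal, MulEquiv.symm_apply_apply, hσ]

variable {𝔩}

/-- **"The set `{x_a : a}` is `{1, 2, …, p-1}`"** [Schoof2009, p. 64]: there is `a ∈ (ℤ/pℤ)ˣ` with
`ord_{P_{ab}}(g(χ)) = b` (the representative of `b` in `[1, p-1]`) for every `b`. From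
`x(P_{cb}) ≡ b x(P_c) (mod p)` and `1 ≤ x ≤ p - 1`. [cite: Schoof2009, Theorem 9.5 (proof, p. 64)] -/
theorem exists_good {χ : MulChar (ZMod l) (𝓞 K)} (hχ : orderOf χ = p) (hp2 : p ≠ 2)
    (hpl : p ∣ l - 1) (hl𝔩 : (l : 𝓞 K) ∈ 𝔩) :
    ∃ a : (ZMod p)ˣ, ∀ b : (ZMod p)ˣ,
      ord (Pc 𝔩 (a * b)) (Ideal.span {gElt χ}) = (b : ZMod p).val := by
  have hlp : l ≠ p := by
    rintro rfl
    have h2 := hl.out.two_le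
    have := Nat.le_of_dvd (by omega) hpl
    omega
  set y : (ZMod p)ˣ → ℕ := fun c => ord (Pc 𝔩 c) (Ideal.span {gElt χ}) with hy
  -- `y(c) ≤ p - 1` and `1 ≤ y(c)`
  have hy1 : ∀ c, 1 ≤ y c := fun c => one_le_ord hχ hp2 (mem_Pc 𝔩 hl𝔩)
  have hyp : ∀ c, y c < p := by
    intro c
    have h := ord_add_ord_neg hχ hp2 hlp (Q := Pc 𝔩 c) (mem_Pc 𝔩 hl𝔩)
    have h1 : 1 ≤ ord ((gal p K (-1))⁻¹ • Pc 𝔩 c) (Ideal.span {gElt χ}) := by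
      rw [← Pc_mul]
      exact hy1 _
    change y c + _ = p at h
    omega
  -- the congruence `y(c b) ≡ b y(c) (mod p)` in `ZMod p`
  have hcong : ∀ c b : (ZMod p)ˣ, ((y (c * b) : ℕ) : ZMod p) = (b : ZMod p) * (y c : ℕ) := by
    intro c b
    have h := val_mul_ord hχ hp2 (Pc 𝔩 c) (ne_bot_of_mem (mem_Pc 𝔩 hl𝔩)) b
    rw [← Pc_mul] at h
    have h' := congrArg (Nat.cast : ℕ → ZMod p) h
    push_cast at h'
    rw [ZMod.natCast_zmod_val, ZMod.natCast_self, zero_mul, add_zero] at h'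
    exact h'.symm
  -- `Y(1) ≠ 0`
  have hY1 : ((y 1 : ℕ) : ZMod p) ≠ 0 := by
    rw [Ne, ZMod.natCast_eq_zero_iff]
    intro h
    have := Nat.le_of_dvd (hy1 1) h
    have := hyp 1
    omega
  set u : (ZMod p)ˣ := Units.mk0 _ hY1 with hu
  refine ⟨u⁻¹, fun b => ?_⟩
  have h1 := hcong 1 (u⁻¹ * b)
  rw [one_mul] at h1
  have h2 : ((y (u⁻¹ * b) : ℕ) : ZMod p) = ((b : ZMod p).val : ZMod p) := by
    rw [h1, ZMod.natCast_zmod_val, Units.val_mul, Units.val_inv_eq_inv_val, hu, Units.val_mk0]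
    field_simp
  rw [ZMod.natCast_eq_natCast_iff', Nat.mod_eq_of_lt (hyp _), Nat.mod_eq_of_lt (ZMod.val_lt _)] at h2
  exact h2

omit hK in
/-- `D_b(χ)` divides `l^{pb}`; so a prime containing `D_b(χ)` contains `l`. [folklore] -/
theorem l_mem_of_jacProd_mem {χ : MulChar (ZMod l) (𝓞 K)} (hχ : orderOf χ = p) (hp2 : p ≠ 2)
    {b : ℕ} (hb0 : 0 < b) (hb : b < p) {Q : Ideal (𝓞 K)} [hQ : Q.IsPrime] (h : jacProd χ b ∈ Q) :
    (l : 𝓞 K) ∈ Q := by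
  have e1 := gElt_pow hχ hb0 hb
  have e2 := gElt_mul_gElt_inv hχ hp2
  have : ((l : 𝓞 K) ^ p) ^ b = gElt (χ ^ b) * gElt χ⁻¹ ^ b * jacProd χ b ^ p := by
    rw [← e2, mul_pow, e1]; ring
  have hmem : ((l : 𝓞 K) ^ p) ^ b ∈ Q := by
    rw [this]
    exact Q.mul_mem_left _ (Q.pow_mem_of_mem h p hp.out.pos)
  exact hQ.mem_of_pow_mem _ (hQ.mem_of_pow_mem _ hmem)

/-- **[Schoof2009, Theorem 9.5], explicit form for `θ_b`** (`1 ≤ b ≤ p - 1`): for a prime `𝔩` of degree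
one over `l ≡ 1 (mod p)` and the good `a` of `exists_good`,
`𝔩^{θ_b} = ∏_c (σ_c⁻¹ 𝔩)^{⌊bc/p⌋} = (σ_a D_b(χ))`, `D_b(χ) = ∏_{j<b} J(χ, χ^j)` — i.e. the classical
factorisation of Jacobi sums. (Schoof: `𝔩^{θ_i} = σ_a(τ^{i-σ_i})`; we compare exponents prime by
prime, using `val_mul_ord`.) [cite: Schoof2009, Theorem 9.5 (proof, p. 64)] -/
theorem prod_Pc_pow_quot_eq_span {χ : MulChar (ZMod l) (𝓞 K)} (hχ : orderOf χ = p) (hp2 : p ≠ 2)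
    (hpl : p ∣ l - 1) (hl𝔩 : (l : 𝓞 K) ∈ 𝔩) {a : (ZMod p)ˣ}
    (ha : ∀ b : (ZMod p)ˣ, ord (Pc 𝔩 (a * b)) (Ideal.span {gElt χ}) = (b : ZMod p).val)
    {b : ℕ} (hb0 : 0 < b) (hb : b < p) :
    ∏ c : (ZMod p)ˣ, Pc 𝔩 c ^ quot p b c = Ideal.span {gal p K a • jacProd χ b} := by
  classical
  have hD := jacProd_ne_zero hχ hp2 hb0 hb
  have hPc0 : ∀ c : (ZMod p)ˣ, Pc 𝔩 c ≠ ⊥ := fun c => ne_bot_of_mem (mem_Pc 𝔩 hl𝔩)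
  have hprod0 : ∏ c : (ZMod p)ˣ, Pc 𝔩 c ^ quot p b c ≠ ⊥ :=
    Finset.prod_ne_zero_iff.mpr fun c _ => pow_ne_zero _ (hPc0 c)
  have hspan0 : Ideal.span {gal p K a • jacProd χ b} ≠ ⊥ := by
    rw [← span_smul_singleton]
    intro h0
    have := congrArg (fun J : Ideal (𝓞 K) => (gal p K a)⁻¹ • J) h0
    simp only [inv_smul_smul, Ideal.smul_bot] at this
    exact (Ideal.span_singleton_eq_bot.not.mpr hD) this
  apply eq_of_ord_eq hprod0 hspan0
  intro Q hQ hQ0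
  rw [ord_prod _ _ _ fun c _ => pow_ne_zero _ (hPc0 c), ← span_smul_singleton,
    ord_smul' _ hQ0 (Ideal.span_singleton_eq_bot.not.mpr hD)]
  simp only [ord_pow]
  by_cases hlQ : (l : 𝓞 K) ∈ Q
  · -- `Q = P_{c₀}`
    obtain ⟨c₀, rfl⟩ := exists_Pc_eq (p := p) 𝔩 hl𝔩 hlQ
    have hinj := Pc_injective 𝔩 hpl hl𝔩
    rw [Finset.sum_eq_single c₀, ord_self (hPc0 c₀), mul_one]
    · -- the value at `P_{c₀}`: `ord_{σ_a⁻¹ P_{c₀}}(D_b) = ⌊b c₀ / p⌋`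
      rw [← Pc_mul]
      let bu : (ZMod p)ˣ := ZMod.unitOfCoprime b (Nat.coprime_of_lt_prime hb0.ne' hb hp.out).symm
      have hbu : (bu : ZMod p).val = b := by
        rw [ZMod.coe_unitOfCoprime, ZMod.val_natCast, Nat.mod_eq_of_lt hb]
      have h := val_mul_ord hχ hp2 (Pc 𝔩 (c₀ * a)) (hPc0 _) bu
      have e1 : ord (Pc 𝔩 (c₀ * a)) (Ideal.span {gElt χ}) = (c₀ : ZMod p).val := by
        rw [mul_comm]; exact ha c₀
      have e2 : ord ((gal p K bu)⁻¹ • Pc 𝔩 (c₀ * a)) (Ideal.span {gElt χ}) =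
          ((c₀ * bu : (ZMod p)ˣ) : ZMod p).val := by
        rw [← Pc_mul, show c₀ * a * bu = a * (c₀ * bu) by rw [mul_comm c₀ a, mul_assoc]]
        exact ha _
      have hval : ((c₀ * bu : (ZMod p)ˣ) : ZMod p).val = (b * (c₀ : ZMod p).val) % p := by
        rw [Units.val_mul, ZMod.val_mul, hbu, mul_comm]
      rw [e1, e2, hval, hbu] at h
      rw [quot]
      have hdm := Nat.div_add_mod (b * (c₀ : ZMod p).val) p
      have hp0 : 0 < p := hp.out.pos
      have : p * ord (Pc 𝔩 (c₀ * a)) (Ideal.span {jacProd χ b}) = p * (b * (c₀ : ZMod p).val / p) := by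
        linarith
      exact (Nat.eq_of_mul_eq_mul_left hp0 this).symm
    · intro c _ hc
      rw [ord_eq_zero_of_ne (hPc0 c) (fun h => hc (hinj h).symm)]  -- hmm orientation
      simp
    · intro h; exact absurd (Finset.mem_univ c₀) h
  · -- `Q` does not lie over `l`: both sides vanish
    have h1 : ∀ c : (ZMod p)ˣ, ord Q (Pc 𝔩 c) = 0 := by
      intro c
      apply ord_eq_zero_of_ne (hPc0 c)
      rintro rfl
      exact hlQ (mem_Pc 𝔩 hl𝔩)
    simp only [h1, mul_zero, Finset.sum_const_zero]
    symm
    by_contra hne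
    have hle := (ord_ne_zero_iff ?_ (Ideal.span_singleton_eq_bot.not.mpr hD)).mp hne
    · rw [Ideal.span_singleton_le_iff_mem] at hle
      have := l_mem_of_jacProd_mem hχ hp2 hb0 hb hle
      rw [Ideal.mem_inv_pointwise_smul_iff, gal_smul_natCast] at this
      exact hlQ this
    · intro h0
      apply hQ0
      have := congrArg (fun J : Ideal (𝓞 K) => gal p K a • J) h0
      simpa only [smul_inv_smul, Ideal.smul_bot] using this

/-- **[Schoof2009, Theorem 9.5], explicit form for `θ_p`**: `𝔩^{θ_p} = ∏_c (σ_c⁻¹ 𝔩)^{c} = (σ_a g(χ))`,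
`g(χ) = τ(χ)^p` — Schoof's "`𝔩^{θ_p} = σ_a(τ^p)`, in particular `𝔩^{θ_p}` is principal".
[cite: Schoof2009, Theorem 9.5 (proof, p. 64)] -/
theorem prod_Pc_pow_val_eq_span {χ : MulChar (ZMod l) (𝓞 K)} (hχ : orderOf χ = p) (hp2 : p ≠ 2)
    (hpl : p ∣ l - 1) (hl𝔩 : (l : 𝓞 K) ∈ 𝔩) {a : (ZMod p)ˣ}
    (ha : ∀ b : (ZMod p)ˣ, ord (Pc 𝔩 (a * b)) (Ideal.span {gElt χ}) = (b : ZMod p).val) :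
    ∏ c : (ZMod p)ˣ, Pc 𝔩 c ^ (c : ZMod p).val = Ideal.span {gal p K a • gElt χ} := by
  classical
  have hg := gElt_ne_zero hχ hp2
  have hPc0 : ∀ c : (ZMod p)ˣ, Pc 𝔩 c ≠ ⊥ := fun c => ne_bot_of_mem (mem_Pc 𝔩 hl𝔩)
  have hprod0 : ∏ c : (ZMod p)ˣ, Pc 𝔩 c ^ (c : ZMod p).val ≠ ⊥ :=
    Finset.prod_ne_zero_iff.mpr fun c _ => pow_ne_zero _ (hPc0 c)
  have hspan0 : Ideal.span {gal p K a • gElt χ} ≠ ⊥ := by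
    rw [← span_smul_singleton]
    intro h0
    have := congrArg (fun J : Ideal (𝓞 K) => (gal p K a)⁻¹ • J) h0
    simp only [inv_smul_smul, Ideal.smul_bot] at this
    exact (Ideal.span_singleton_eq_bot.not.mpr hg) this
  apply eq_of_ord_eq hprod0 hspan0
  intro Q hQ hQ0
  rw [ord_prod _ _ _ fun c _ => pow_ne_zero _ (hPc0 c), ← span_smul_singleton,
    ord_smul' _ hQ0 (Ideal.span_singleton_eq_bot.not.mpr hg)]
  simp only [ord_pow]
  by_cases hlQ : (l : 𝓞 K) ∈ Q
  · obtain ⟨c₀, rfl⟩ := exists_Pc_eq (p := p) 𝔩 hl𝔩 hlQ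
    have hinj := Pc_injective 𝔩 hpl hl𝔩
    rw [Finset.sum_eq_single c₀, ord_self (hPc0 c₀), mul_one, ← Pc_mul, mul_comm c₀ a, ha c₀]
    · intro c _ hc
      rw [ord_eq_zero_of_ne (hPc0 c) (fun h => hc (hinj h).symm)]
      simp
    · intro h; exact absurd (Finset.mem_univ c₀) h
  · have h1 : ∀ c : (ZMod p)ˣ, ord Q (Pc 𝔩 c) = 0 := by
      intro c
      apply ord_eq_zero_of_ne (hPc0 c)
      rintro rfl
      exact hlQ (mem_Pc 𝔩 hl𝔩)
    simp only [h1, mul_zero, Finset.sum_const_zero]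
    symm
    by_contra hne
    have hle := (ord_ne_zero_iff ?_ (Ideal.span_singleton_eq_bot.not.mpr hg)).mp hne
    · rw [Ideal.span_singleton_le_iff_mem] at hle
      -- `g ∣ l^p`, so `l ∈ σ_a⁻¹ Q`, so `l ∈ Q`
      have hmem : (l : 𝓞 K) ^ p ∈ (gal p K a)⁻¹ • Q := by
        rw [← gElt_mul_gElt_inv hχ hp2]
        exact Ideal.mul_mem_right _ _ hle
      have := Ideal.IsPrime.mem_of_pow_mem inferInstance _ hmem
      rw [Ideal.mem_inv_pointwise_smul_iff, gal_smul_natCast] at this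
      exact hlQ this
    · intro h0
      apply hQ0
      have := congrArg (fun J : Ideal (𝓞 K) => gal p K a • J) h0
      simpa only [smul_inv_smul, Ideal.smul_bot] using this

end DegreeOne

section Export

/-! ### Stickelberger's theorem for primes of degree one -/

variable {p : ℕ} [hp : Fact p.Prime] {K : Type*} [Field K] [NumberField K]
  [hK : IsCyclotomicExtension {p} ℚ K]

/-- `𝔞^θ` for `θ = ∑_c n_c σ_c⁻¹ ∈ ℤ[G]` with non-negative coefficients `n`: the ideal
`∏_c (σ_c⁻¹ 𝔞)^{n c}` ("exponential notation for the action of `ℤ[G]`", [Schoof2009, Ch. 7, p. 41]).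
[cite: Schoof2009, Ch. 7 (p. 41)] -/
noncomputable def idealPow (n : (ZMod p)ˣ → ℕ) (𝔞 : Ideal (𝓞 K)) : Ideal (𝓞 K) :=
  ∏ c : (ZMod p)ˣ, ((gal p K c)⁻¹ • 𝔞) ^ n c

/-- `(I J)^θ = I^θ J^θ`. [folklore] -/
theorem idealPow_mul (n : (ZMod p)ˣ → ℕ) (I J : Ideal (𝓞 K)) :
    idealPow n (I * J) = idealPow n I * idealPow n J := by
  unfold idealPow
  rw [← Finset.prod_mul_distrib]
  apply Finset.prod_congr rfl
  intro c _
  rw [← mul_pow]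
  congr 1
  rw [Ideal.pointwise_smul_def, Ideal.pointwise_smul_def, Ideal.pointwise_smul_def, Ideal.map_mul]

/-- `(1)^θ = (1)`. [folklore] -/
theorem idealPow_top (n : (ZMod p)ˣ → ℕ) : idealPow n (⊤ : Ideal (𝓞 K)) = ⊤ := by
  unfold idealPow
  rw [← Ideal.one_eq_top]
  apply Finset.prod_eq_one
  intro c _
  rw [Ideal.one_eq_top, Ideal.pointwise_smul_def, Ideal.map_top, Ideal.top_pow]

/-- `I^{θ + θ'} = I^θ I^{θ'}`. [folklore] -/
theorem idealPow_add (n m : (ZMod p)ˣ → ℕ) (I : Ideal (𝓞 K)) :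
    idealPow (n + m) I = idealPow n I * idealPow m I := by
  unfold idealPow
  rw [← Finset.prod_mul_distrib]
  apply Finset.prod_congr rfl
  intro c _
  rw [Pi.add_apply, pow_add]

/-- `(∏ I_i)^θ = ∏ I_i^θ` (multiset version). [folklore] -/
theorem idealPow_multiset_prod (n : (ZMod p)ˣ → ℕ) (M : Multiset (Ideal (𝓞 K))) :
    idealPow n M.prod = (M.map (idealPow n)).prod := by
  induction M using Multiset.induction_on with
  | empty => simp [idealPow_top]
  | cons a M ih => rw [Multiset.prod_cons, idealPow_mul, ih, Multiset.map_cons, Multiset.prod_cons]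

/-- `I^θ ≠ 0` for `I ≠ 0`. [folklore] -/
theorem idealPow_ne_bot (n : (ZMod p)ˣ → ℕ) {I : Ideal (𝓞 K)} (hI : I ≠ ⊥) : idealPow n I ≠ ⊥ := by
  unfold idealPow
  apply Finset.prod_ne_zero_iff.mpr
  intro c _
  apply pow_ne_zero
  intro h0
  apply hI
  have := congrArg (fun J : Ideal (𝓞 K) => gal p K c • J) h0
  simpa only [smul_inv_smul, Submodule.zero_eq_bot, Ideal.smul_bot] using this

/-- A product of two principal ideals is principal. [folklore] -/
theorem isPrincipal_mul {R : Type*} [CommRing R] {I J : Ideal R} (hI : I.IsPrincipal)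
    (hJ : J.IsPrincipal) : (I * J).IsPrincipal := by
  obtain ⟨x, hx⟩ := hI
  obtain ⟨y, hy⟩ := hJ
  refine ⟨x * y, ?_⟩
  rw [hx, hy, Ideal.submodule_span_eq, Ideal.submodule_span_eq, Ideal.submodule_span_eq,
    Ideal.span_singleton_mul_span_singleton]

/-- A product of principal ideals is principal. [folklore] -/
theorem isPrincipal_multiset_prod {R : Type*} [CommRing R] {M : Multiset (Ideal R)}
    (h : ∀ I ∈ M, I.IsPrincipal) : M.prod.IsPrincipal := by
  induction M using Multiset.induction_on with
  | empty => rw [Multiset.prod_zero, Ideal.one_eq_top]; exact ⟨1, by simp⟩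
  | cons a M ih =>
    rw [Multiset.prod_cons]
    exact isPrincipal_mul (h a (Multiset.mem_cons_self a M))
      (ih fun I hI => h I (Multiset.mem_cons_of_mem hI))

/-- Cancellation in a Dedekind domain: if `I ≠ 0` and `I`, `I J` are principal then `J` is principal.
[folklore] -/
theorem isPrincipal_of_mul {R : Type*} [CommRing R] [IsDedekindDomain R] {I J : Ideal R}
    (hI0 : I ≠ ⊥) (hI : I.IsPrincipal) (hIJ : (I * J).IsPrincipal) : J.IsPrincipal := by
  obtain ⟨v, hv⟩ := hI
  obtain ⟨u, hu⟩ := hIJ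
  rw [Ideal.submodule_span_eq] at hv hu
  have hu' : u ∈ I * J := by rw [hu]; exact Ideal.mem_span_singleton_self u
  have : u ∈ I := Ideal.mul_le_right hu'
  rw [hv, Ideal.mem_span_singleton] at this
  obtain ⟨w, rfl⟩ := this
  refine ⟨w, ?_⟩
  rw [Ideal.submodule_span_eq]
  have hv0 : Ideal.span {v} ≠ ⊥ := by rw [← hv]; exact hI0
  apply mul_left_cancel₀ hv0
  rw [← hv, hu, hv, Ideal.span_singleton_mul_span_singleton]

/-- **Stickelberger's theorem for primes of degree one, `θ_b` [Schoof2009, Theorem 9.5]** (Kummer 1847,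
Stickelberger 1890): for an odd prime `p`, `K = ℚ(ζ_p)`, a prime `l ≡ 1 (mod p)` and a prime `𝔩` of
`𝓞 K` above `l`, the ideal `𝔩^{θ_b} = ∏_c (σ_c⁻¹ 𝔩)^{⌊bc/p⌋}` is principal, for every `b ∈ ℕ`
(`θ_{b+p} = θ_b + θ_p` reduces to `b ≤ p`). [cite: Schoof2009, Theorem 9.5] -/
theorem isPrincipal_idealPow_quot (hp2 : p ≠ 2) {l : ℕ} [hl : Fact l.Prime] (hpl : p ∣ l - 1)
    (𝔩 : Ideal (𝓞 K)) [𝔩.IsPrime] (hl𝔩 : (l : 𝓞 K) ∈ 𝔩) (b : ℕ) :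
    (idealPow (quot p b) 𝔩).IsPrincipal := by
  obtain ⟨χ, hχ⟩ := MulChar.exists_mulChar_orderOf (ZMod l) (n := p)
    (by rw [ZMod.card]; exact hpl) (zeta_spec p ℚ K).toInteger_isPrimitiveRoot
  obtain ⟨a, ha⟩ := exists_good hχ hp2 hpl hl𝔩
  -- `b = p k + r`
  have key : ∀ k r : ℕ, r < p → (idealPow (quot p (p * k + r)) 𝔩).IsPrincipal := by
    intro k r hr
    induction k with
    | zero =>
      rw [mul_zero, zero_add]
      rcases Nat.eq_zero_or_pos r with rfl | hr0
      · have : quot p 0 = fun _ => 0 := by funext c; simp [quot]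
        rw [this]
        exact ⟨1, by simp [idealPow]⟩
      · have e : idealPow (quot p r) 𝔩 = Ideal.span {gal p K a • jacProd χ r} :=
          prod_Pc_pow_quot_eq_span hχ hp2 hpl hl𝔩 ha hr0 hr
        rw [e]
        exact ⟨_, (Ideal.submodule_span_eq).symm⟩
    | succ k ih =>
      have e : quot p (p * (k + 1) + r) =
          quot p (p * k + r) + fun c : (ZMod p)ˣ => (c : ZMod p).val := by
        funext c
        simp only [quot, Pi.add_apply]
        rw [show (p * (k + 1) + r) * (c : ZMod p).val = (p * k + r) * (c : ZMod p).val +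
            p * (c : ZMod p).val by ring, Nat.add_mul_div_left _ _ hp.out.pos]
      rw [e, idealPow_add]
      apply isPrincipal_mul ih
      have e2 : idealPow (fun c : (ZMod p)ˣ => (c : ZMod p).val) 𝔩 = Ideal.span {gal p K a • gElt χ} :=
        prod_Pc_pow_val_eq_span hχ hp2 hpl hl𝔩 ha
      rw [e2]
      exact ⟨_, (Ideal.submodule_span_eq).symm⟩
  have := key (b / p) (b % p) (Nat.mod_lt _ hp.out.pos)
  rwa [Nat.div_add_mod] at this

/-- **Stickelberger's theorem for primes of degree one, `f_b = θ_{b+1} - θ_b` [Schoof2009, Theorem 9.5]**: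
`𝔩^{f_b} = ∏_c (σ_c⁻¹ 𝔩)^{⌊(b+1)c/p⌋ - ⌊bc/p⌋}` is principal (from `θ_b`, `θ_{b+1}` by cancellation).
[cite: Schoof2009, Theorem 9.5] -/
theorem isPrincipal_idealPow_quot_sub (hp2 : p ≠ 2) {l : ℕ} [hl : Fact l.Prime] (hpl : p ∣ l - 1)
    (𝔩 : Ideal (𝓞 K)) [𝔩.IsPrime] (hl𝔩 : (l : 𝓞 K) ∈ 𝔩) (b : ℕ) :
    (idealPow (fun c => quot p (b + 1) c - quot p b c) 𝔩).IsPrincipal := by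
  apply isPrincipal_of_mul (idealPow_ne_bot _ (ne_bot_of_mem hl𝔩))
    (isPrincipal_idealPow_quot hp2 hpl 𝔩 hl𝔩 b)
  rw [← idealPow_add]
  have : (quot p b + fun c => quot p (b + 1) c - quot p b c) = quot p (b + 1) := by
    funext c
    simp only [Pi.add_apply]
    exact Nat.add_sub_cancel' (le_quot_succ b c)
  rw [this]
  exact isPrincipal_idealPow_quot hp2 hpl 𝔩 hl𝔩 (b + 1)

/-- From primes of degree one to ideals supported on them: if `I^θ` is principal for every prime `𝔩`
over every `l ≡ 1 (mod p)`, then `I^θ` is principal for every non-zero `I` all of whose prime factors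
lie over such primes. [folklore] -/
theorem isPrincipal_idealPow_of_factors (n : (ZMod p)ˣ → ℕ)
    (hn : ∀ (l : ℕ) [Fact l.Prime] (𝔩 : Ideal (𝓞 K)) [𝔩.IsPrime],
      p ∣ l - 1 → (l : 𝓞 K) ∈ 𝔩 → (idealPow n 𝔩).IsPrincipal)
    {I : Ideal (𝓞 K)} (hI : I ≠ ⊥)
    (hfac : ∀ P ∈ normalizedFactors I, ∃ l : ℕ, l.Prime ∧ p ∣ l - 1 ∧ (l : 𝓞 K) ∈ P) :
    (idealPow n I).IsPrincipal := by
  rw [← Ideal.prod_normalizedFactors_eq_self hI, idealPow_multiset_prod]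
  apply isPrincipal_multiset_prod
  intro J hJ
  obtain ⟨P, hP, rfl⟩ := Multiset.mem_map.mp hJ
  obtain ⟨l, hl, hpl, hlP⟩ := hfac P hP
  haveI := Fact.mk hl
  haveI : P.IsPrime := Ideal.isPrime_of_prime (prime_of_normalized_factor P hP)
  exact hn l P hpl hlP

/-- **[Schoof2009, Theorem 9.5] for `θ_b` and ideals supported on primes of degree one**: if every prime
factor of `I ≠ 0` contains a rational prime `l ≡ 1 (mod p)`, then `I^{θ_b} = ∏_c (σ_c⁻¹ I)^{⌊bc/p⌋}` is
principal. (In the application to Catalan's equation every prime factor `𝔯 ∤ p` of `(x - ζ_p)` is of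
this kind, as `ζ_p ≡ x ∈ ℤ (mod 𝔯)`.) [cite: Schoof2009, Theorem 9.5] -/
theorem isPrincipal_idealPow_quot_of_factors (hp2 : p ≠ 2) {I : Ideal (𝓞 K)} (hI : I ≠ ⊥)
    (hfac : ∀ P ∈ normalizedFactors I, ∃ l : ℕ, l.Prime ∧ p ∣ l - 1 ∧ (l : 𝓞 K) ∈ P) (b : ℕ) :
    (idealPow (quot p b) I).IsPrincipal :=
  isPrincipal_idealPow_of_factors _ (fun _ _ 𝔩 _ hpl hl𝔩 => isPrincipal_idealPow_quot hp2 hpl 𝔩 hl𝔩 b)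
    hI hfac

/-- **[Schoof2009, Theorem 9.5] for `f_b` and ideals supported on primes of degree one**: `I^{f_b}` is
principal. [cite: Schoof2009, Theorem 9.5] -/
theorem isPrincipal_idealPow_quot_sub_of_factors (hp2 : p ≠ 2) {I : Ideal (𝓞 K)} (hI : I ≠ ⊥)
    (hfac : ∀ P ∈ normalizedFactors I, ∃ l : ℕ, l.Prime ∧ p ∣ l - 1 ∧ (l : 𝓞 K) ∈ P) (b : ℕ) :
    (idealPow (fun c => quot p (b + 1) c - quot p b c) I).IsPrincipal :=
  isPrincipal_idealPow_of_factors _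
    (fun _ _ 𝔩 _ hpl hl𝔩 => isPrincipal_idealPow_quot_sub hp2 hpl 𝔩 hl𝔩 b) hI hfac

end Export

end Literature.NumberTheory.NumberFields.Stickelberger
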